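import Literature.Analysis.Calculus.ClosedSubgroupIdentityPrinciple
import Literature.Algebra.Lie.SpecialUnitaryAdjointIrreducible
import Literature.MathematicalPhysics.QuantumLattice.RepKillingForm
import Literature.MathematicalPhysics.QuantumFieldTheory.Balaban1983to89.B12SemisimpleNormalTori
import HarnessLib

/-!
# The trace defect of a unitary representation of `SU(n)` near the identity

Topic `Literature/MathematicalPhysics/QuantumLattice` (cell ym-ir, seat lit-4; classical support file for the
`r`-port of the twisted-slab anchor of route `BalabanLadder`, census row 43 — the hypothesis `(Q)` of
`Theorems/BalabanLadderIRTwistedSlabRepSandwich.lean`).  Nothing here is a claim about the Yang–Mills mass gap.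

For a faithful continuous unitary matrix representation `r : SU(n) → U(N)` (tree `LatticeRep`, `YangMillsOS.lean`)
the Wilson plaquette energies `N − Re tr r(h)` and `n − Re tr h` are comparable near `h = 1` with a CONSTANT ratio:

* §1 `card_sub_trace_re_eq_half_hsForm` — `n − Re tr U = ½‖U − 1‖²_HS` for unitary `U`
  (`‖X‖²_HS = Re tr(XᴴX)`, tree `hsForm`; Hall, Def. 2.2 and (2.2)).
* §2 `tendsto_hsForm_exp_sub_one_div` — `‖e^A − 1‖²_HS ∕ ‖A‖²_HS → 1` as `A → 0`, `A ≠ 0` (second order of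
  the exponential series, from Mathlib's `hasFDerivAt_exp_zero`).
* §3 `exists_eq_mul_hsForm_of_conj_exp_invariant` — SCHUR: a symmetric, positive semi-definite, real bilinear form on
  `𝔰𝔲(n)` which is invariant under `Ad(e^{tZ})`, `Z ∈ 𝔰𝔲(n)`, is `c·⟨·,·⟩_HS` for some `c ≥ 0` (the adjoint action of
  `SU(n)` on `𝔰𝔲(n)` is irreducible, tree `SpecialUnitaryAdjointIrreducible`; Hall, Prop. 7.31 with Thm. 3.20 (4);
  the constant is the Rayleigh minimum, whose level set is the `Ad`-stable radical of `B − c·HS`).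
* §4 `LatticeRep.exists_derivedMap` — the derived map `φ = dr : 𝔰𝔲(n) → 𝔲(N)` of `r` (Hall, Thm. 3.28:
  `r(e^{tX}) = e^{tφ(X)}`, `φ(uXu⁻¹) = r(u)φ(X)r(u)⁻¹`; faithfulness makes `φ` injective on `𝔰𝔲(n)`), read off the
  tree's general `Literature.Analysis.Calculus.exists_linearMap_apply_exp_smul_eq` (closed linear groups).
* §5 `LatticeRep.exists_dynkinIndexHS_tendsto` and **`LatticeRep.exists_tendsto_traceDefect_ratio`** — there is
  `κ > 0`, the DYNKIN INDEX of `r` in Hilbert–Schmidt units (`‖φ X‖²_HS = κ‖X‖²_HS` on `𝔰𝔲(n)`; Kumar, App. A,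
  Def. A.1: `⟨f(x), f(y)⟩ = d_f⟨x, y⟩`, `d_f ≥ 0`), with
  **`(N − Re tr r(h)) ∕ (n − Re tr h) → κ` as `h → 1`, `h ≠ 1`, in `SU(n)`**; `κ = 1` for the fundamental
  representation (`tendsto_traceDefect_ratio_fundamental`).  The `Fin N` form consumed by the `r`-port is
  `LatticeRep.exists_tendsto_traceDefect_ratio_fin`.

Everything is proved; there are no definitions and no named facts.  HONEST FRAMING: classical Lie theory (derived
representation + Schur); width 0 toward any located stub; the Yang–Mills mass gap (Clay) is NOT proved by any of this;
R4 closes only the conditional finite-𝕋⁴ rung `BalabanLadder.UV`.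
`TODO(general form)`: the same statement for a compact SIMPLE `G` presented by two faithful unitary representations
needs the simplicity of `𝔤_r`, which the tree proves Summit-side (`BalabanLadderUVNonSUNRecLieRatio`), not here.

## References

* [Hall2015] B. C. Hall, *Lie Groups, Lie Algebras, and Representations*, 2nd ed., GTM 222 (2015): Def. 2.2 and
  (2.2) (Hilbert–Schmidt norm `‖X‖² = tr(X*X)`), Thm. 3.28 (derived homomorphism), Prop. 3.24 (`𝔰𝔲(n)`),
  Thm. 3.20 (4) and Prop. 7.31 (irreducibility ∕ simplicity of `𝔰𝔲(n)`).
* [Kumar2021] S. Kumar, *Conformal Blocks, Generalized Theta Functions and the Verlinde Formula*, CUP (2021),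
  Appendix A, Def. A.1 (Dynkin index: `⟨f x, f y⟩ = d_f ⟨x, y⟩`, `d_f ∈ ℝ_{≥ 0}`).

Mathlib (this pin): `Matrix.specialUnitaryGroup`, `NormedSpace.exp`, `hasFDerivAt_exp_zero`, the scoped
`L^∞`-operator norm `Matrix.Norms.Operator` (all statements are norm-free); no derived representation, no `𝔰𝔲(n)`.
-/

noncomputable section

-- reducibly-different normed/topological instance paths on `Matrix` (as in the tree's matrix-exponential files)
set_option backward.isDefEq.respectTransparency false

open scoped Matrix Matrix.Norms.Operator
open NormedSpace Filter Topology Asymptotics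
open Literature.RepresentationTheory.CompactGroups
open Literature.MathematicalPhysics.QuantumFieldTheory (LatticeRep)
open Literature.Algebra.Lie.SpecialUnitaryAdjointIrreducible (eq_bot_or_forall_mem_of_forall_conj_exp_mem
  star_exp_smul_of_conjTranspose_eq_neg)
open Literature.MathematicalPhysics.QuantumFieldTheory.Balaban1983to89.B12SemisimpleNormalTori
  (isClosedUnitaryGroup_specialUnitaryGroup)

namespace Literature.MathematicalPhysics.QuantumLattice

variable {n : Type*} [Fintype n] [DecidableEq n]

/-! ## §1 The trace defect is half the squared Hilbert–Schmidt distance to `1` -/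

/-- `‖U − 1‖²_HS = 2(n − Re tr U)` for a unitary `U` (`(U−1)ᴴ(U−1) = 2·1 − U − Uᴴ`).
[cite: Hall2015, Def. 2.2 and (2.2)] -/
theorem hsForm_sub_one_self_of_mem_unitaryGroup {U : Matrix n n ℂ}
    (hU : U ∈ Matrix.unitaryGroup n ℂ) :
    hsForm (U - 1) (U - 1) = 2 * ((Fintype.card n : ℝ) - U.trace.re) := by
  have h1 : Uᴴ * U = 1 := by
    have h := Matrix.mem_unitaryGroup_iff'.1 hU
    rwa [Matrix.star_eq_conjTranspose] at h
  have hre : (Uᴴ.trace).re = U.trace.re := by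
    rw [Matrix.trace_conjTranspose, Complex.star_def, Complex.conj_re]
  have hprod : (U - 1)ᴴ * (U - 1) = 1 - Uᴴ - (U - 1) := by
    rw [Matrix.conjTranspose_sub, Matrix.conjTranspose_one, Matrix.sub_mul, Matrix.mul_sub, h1,
      Matrix.mul_one, Matrix.one_mul]
  rw [hsForm_def, hprod, Matrix.trace_sub, Matrix.trace_sub, Matrix.trace_sub, Matrix.trace_one,
    Complex.sub_re, Complex.sub_re, Complex.sub_re, Complex.natCast_re, hre]
  ring

/-- **`n − Re tr U = ½‖U − 1‖²_HS` for unitary `U`**: the Wilson plaquette energy is half the squared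
Hilbert–Schmidt distance to the identity. [cite: Hall2015, Def. 2.2 and (2.2)] -/
theorem card_sub_trace_re_eq_half_hsForm {U : Matrix n n ℂ} (hU : U ∈ Matrix.unitaryGroup n ℂ) :
    (Fintype.card n : ℝ) - U.trace.re = (1 / 2) * hsForm (U - 1) (U - 1) := by
  rw [hsForm_sub_one_self_of_mem_unitaryGroup hU]; ring

/-! ## §2 Second order: `‖e^A − 1‖²_HS ∕ ‖A‖²_HS → 1` -/

omit [DecidableEq n] in
/-- A real bilinear form on `M_n(ℂ)` is jointly continuous (finite dimensions). [folklore] -/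
private theorem continuous_bilin_uncurry (B : Matrix n n ℂ →ₗ[ℝ] Matrix n n ℂ →ₗ[ℝ] ℝ) :
    Continuous fun p : Matrix n n ℂ × Matrix n n ℂ => B p.1 p.2 := by
  let B' : Matrix n n ℂ →ₗ[ℝ] (Matrix n n ℂ →L[ℝ] ℝ) :=
    (LinearMap.toContinuousLinearMap :
        (Matrix n n ℂ →ₗ[ℝ] ℝ) ≃ₗ[ℝ] (Matrix n n ℂ →L[ℝ] ℝ)).toLinearMap ∘ₗ B
  let Bc : Matrix n n ℂ →L[ℝ] Matrix n n ℂ →L[ℝ] ℝ := LinearMap.toContinuousLinearMap B'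
  exact Bc.continuous₂

/-- A real bilinear form on `M_n(ℂ)` is bounded: `|B X Y| ≤ M‖X‖‖Y‖` (finite dimensions). [folklore] -/
private theorem exists_abs_bilin_le (B : Matrix n n ℂ →ₗ[ℝ] Matrix n n ℂ →ₗ[ℝ] ℝ) :
    ∃ M : ℝ, 0 ≤ M ∧ ∀ X Y : Matrix n n ℂ, |B X Y| ≤ M * ‖X‖ * ‖Y‖ := by
  let B' : Matrix n n ℂ →ₗ[ℝ] (Matrix n n ℂ →L[ℝ] ℝ) :=
    (LinearMap.toContinuousLinearMap :
        (Matrix n n ℂ →ₗ[ℝ] ℝ) ≃ₗ[ℝ] (Matrix n n ℂ →L[ℝ] ℝ)).toLinearMap ∘ₗ B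
  let Bc : Matrix n n ℂ →L[ℝ] Matrix n n ℂ →L[ℝ] ℝ := LinearMap.toContinuousLinearMap B'
  refine ⟨‖Bc‖, Bc.opNorm_nonneg, fun X Y => ?_⟩
  have h := Bc.le_opNorm₂ X Y
  have hXY : Bc X Y = B X Y := rfl
  rwa [hXY, Real.norm_eq_abs] at h

omit [DecidableEq n] in
/-- The Hilbert–Schmidt form as a real bilinear map. [folklore] -/
private theorem exists_bilin_hsForm :
    ∃ B : Matrix n n ℂ →ₗ[ℝ] Matrix n n ℂ →ₗ[ℝ] ℝ, ∀ X Y, B X Y = hsForm X Y :=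
  ⟨LinearMap.mk₂ ℝ hsForm hsForm_add_left (fun c X Y => hsForm_smul_left X Y c) hsForm_add_right
    (fun c X Y => hsForm_smul_right X Y c), fun _ _ => rfl⟩

/-- `|⟨A, B⟩_HS| ≤ M‖A‖‖B‖` for some `M ≥ 0` (any fixed norm; here Mathlib's `L^∞` operator norm).
[cite: Hall2015, Def. 2.2 and (2.3)–(2.4)] -/
theorem exists_abs_hsForm_le_mul_norm_mul_norm :
    ∃ M : ℝ, 0 ≤ M ∧ ∀ A B : Matrix n n ℂ, |hsForm A B| ≤ M * ‖A‖ * ‖B‖ := by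
  obtain ⟨B, hB⟩ := exists_bilin_hsForm (n := n)
  obtain ⟨M, hM0, hM⟩ := exists_abs_bilin_le B
  exact ⟨M, hM0, fun X Y => hB X Y ▸ hM X Y⟩

omit [DecidableEq n] in
/-- `A ↦ ‖A‖²_HS` is continuous. [cite: Hall2015, Def. 2.2] -/
theorem continuous_hsForm_self : Continuous fun A : Matrix n n ℂ => hsForm A A := by
  obtain ⟨B, hB⟩ := exists_bilin_hsForm (n := n)
  simp_rw [← hB]
  exact (continuous_bilin_uncurry B).comp (continuous_id.prodMk continuous_id)

/-- **Equivalence of the Hilbert–Schmidt norm with the ambient norm, lower half**: `m‖A‖² ≤ ‖A‖²_HS` for some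
`m > 0` (compactness of the unit sphere). [cite: Hall2015, Def. 2.2 (remark after (2.4))] -/
theorem exists_pos_mul_norm_sq_le_hsForm :
    ∃ m : ℝ, 0 < m ∧ ∀ A : Matrix n n ℂ, m * ‖A‖ ^ 2 ≤ hsForm A A := by
  have hsph : ∀ A : Matrix n n ℂ, A ≠ 0 → ‖A‖⁻¹ • A ∈ Metric.sphere (0 : Matrix n n ℂ) 1 := fun A hA => by
    rw [mem_sphere_zero_iff_norm, norm_smul, norm_inv, norm_norm, inv_mul_cancel₀ (norm_ne_zero_iff.2 hA)]
  rcases (Metric.sphere (0 : Matrix n n ℂ) 1).eq_empty_or_nonempty with he | hne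
  · refine ⟨1, one_pos, fun A => ?_⟩
    by_cases hA : A = 0
    · subst hA; simp [hsForm_self_nonneg]
    · exact absurd (hsph A hA) (by simp [he])
  · obtain ⟨A₀, hA₀, hmin⟩ :=
      (isCompact_sphere (0 : Matrix n n ℂ) 1).exists_isMinOn hne continuous_hsForm_self.continuousOn
    have hA₀0 : A₀ ≠ 0 := by
      intro h; rw [h, mem_sphere_zero_iff_norm, norm_zero] at hA₀; exact zero_ne_one hA₀
    refine ⟨hsForm A₀ A₀, hsForm_self_pos hA₀0, fun A => ?_⟩
    by_cases hA : A = 0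
    · subst hA
      simp [(hsForm_self_eq_zero_iff (0 : Matrix n n ℂ)).2 rfl]
    · have hpos : 0 < ‖A‖ := norm_pos_iff.2 hA
      have h := (isMinOn_iff.1 hmin) _ (hsph A hA)
      rw [hsForm_smul_left, hsForm_smul_right] at h
      calc hsForm A₀ A₀ * ‖A‖ ^ 2 ≤ ‖A‖⁻¹ * (‖A‖⁻¹ * hsForm A A) * ‖A‖ ^ 2 := by gcongr
        _ = hsForm A A := by field_simp

/-- **SECOND ORDER OF THE EXPONENTIAL IN HILBERT–SCHMIDT NORM: `‖e^A − 1‖²_HS ∕ ‖A‖²_HS → 1` as `A → 0`,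
`A ≠ 0`** (`e^A − 1 = A + O(‖A‖²)`). [cite: Hall2015, Def. 2.2 and §2.1–§2.3 (power series of `e^X`)] -/
theorem tendsto_hsForm_exp_sub_one_div :
    Tendsto (fun A : Matrix n n ℂ => hsForm (exp A - 1) (exp A - 1) / hsForm A A) (𝓝[≠] 0) (𝓝 1) := by
  obtain ⟨M, hM0, hM⟩ := exists_abs_hsForm_le_mul_norm_mul_norm (n := n)
  obtain ⟨m, hm0, hm⟩ := exists_pos_mul_norm_sq_le_hsForm (n := n)
  -- the remainder `R A = e^A − 1 − A` is `o(A)`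
  have hR : (fun A : Matrix n n ℂ => exp A - 1 - A) =o[𝓝 0] fun A => A := by
    have h := (hasFDerivAt_iff_isLittleO_nhds_zero.1
      (hasFDerivAt_exp_zero (𝕂 := ℝ) (𝔸 := Matrix n n ℂ)))
    simpa only [zero_add, exp_zero, one_apply_eq_self] using h
  have hRn : (fun A : Matrix n n ℂ => ‖exp A - 1 - A‖) =o[𝓝 0] fun A => ‖A‖ := hR.norm_norm
  have hAn : (fun A : Matrix n n ℂ => ‖A‖) =O[𝓝 0] fun A => ‖A‖ := isBigO_refl _ _
  have hdiff : ∀ A : Matrix n n ℂ, hsForm (exp A - 1) (exp A - 1) - hsForm A A =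
      2 * hsForm A (exp A - 1 - A) + hsForm (exp A - 1 - A) (exp A - 1 - A) := by
    intro A
    obtain ⟨R, hR⟩ : ∃ R, exp A - 1 - A = R := ⟨_, rfl⟩
    have hE : exp A - 1 = A + R := by rw [← hR]; abel
    rw [hR, hE, hsForm_add_left, hsForm_add_right, hsForm_add_right, hsForm_comm R A]
    ring
  have h1 : (fun A : Matrix n n ℂ => 2 * hsForm A (exp A - 1 - A)) =o[𝓝 0] fun A => ‖A‖ * ‖A‖ := by
    have hb : (fun A : Matrix n n ℂ => 2 * hsForm A (exp A - 1 - A)) =O[𝓝 0]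
        fun A => ‖A‖ * ‖exp A - 1 - A‖ := by
      refine IsBigO.of_bound (2 * M) (Eventually.of_forall fun A => ?_)
      rw [Real.norm_eq_abs, Real.norm_eq_abs, abs_mul, abs_two,
        abs_of_nonneg (mul_nonneg (norm_nonneg _) (norm_nonneg _))]
      calc 2 * |hsForm A (exp A - 1 - A)| ≤ 2 * (M * ‖A‖ * ‖exp A - 1 - A‖) := by
            gcongr; exact hM _ _
        _ = 2 * M * (‖A‖ * ‖exp A - 1 - A‖) := by ring
    exact hb.trans_isLittleO (hAn.mul_isLittleO hRn)
  have h2 : (fun A : Matrix n n ℂ => hsForm (exp A - 1 - A) (exp A - 1 - A)) =o[𝓝 0]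
      fun A => ‖A‖ * ‖A‖ := by
    have hb : (fun A : Matrix n n ℂ => hsForm (exp A - 1 - A) (exp A - 1 - A)) =O[𝓝 0]
        fun A => ‖exp A - 1 - A‖ * ‖exp A - 1 - A‖ := by
      refine IsBigO.of_bound M (Eventually.of_forall fun A => ?_)
      rw [Real.norm_eq_abs, Real.norm_eq_abs, abs_mul, abs_norm]
      calc |hsForm (exp A - 1 - A) (exp A - 1 - A)| ≤ M * ‖exp A - 1 - A‖ * ‖exp A - 1 - A‖ := hM _ _
        _ = M * (‖exp A - 1 - A‖ * ‖exp A - 1 - A‖) := by ring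
    exact hb.trans_isLittleO (hRn.mul hRn)
  have h3 : (fun A : Matrix n n ℂ => ‖A‖ * ‖A‖) =O[𝓝 0] fun A => hsForm A A := by
    refine IsBigO.of_bound m⁻¹ (Eventually.of_forall fun A => ?_)
    rw [Real.norm_eq_abs, Real.norm_eq_abs, abs_of_nonneg (mul_nonneg (norm_nonneg _) (norm_nonneg _)),
      abs_of_nonneg (hsForm_self_nonneg A)]
    calc ‖A‖ * ‖A‖ = ‖A‖ ^ 2 := (sq _).symm
      _ ≤ hsForm A A / m := (le_div_iff₀' hm0).2 (hm A)
      _ = m⁻¹ * hsForm A A := div_eq_inv_mul _ _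
  have hkey : (fun A : Matrix n n ℂ => hsForm (exp A - 1) (exp A - 1) - hsForm A A) =o[𝓝 0]
      fun A => hsForm A A :=
    ((h1.add h2).trans_isBigO h3).congr' (Eventually.of_forall fun A => (hdiff A).symm) EventuallyEq.rfl
  have hlim : Tendsto (fun A : Matrix n n ℂ =>
      (hsForm (exp A - 1) (exp A - 1) - hsForm A A) / hsForm A A) (𝓝[≠] 0) (𝓝 0) :=
    (hkey.mono nhdsWithin_le_nhds).tendsto_div_nhds_zero
  have heq : (fun A : Matrix n n ℂ => 1 + (hsForm (exp A - 1) (exp A - 1) - hsForm A A) / hsForm A A)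
      =ᶠ[𝓝[≠] 0] fun A => hsForm (exp A - 1) (exp A - 1) / hsForm A A := by
    refine eventually_mem_nhdsWithin.mono fun A hA => ?_
    have hA' : hsForm A A ≠ 0 := (hsForm_self_pos hA).ne'
    simp only [sub_div, div_self hA']
    ring
  simpa using (tendsto_const_nhds.add hlim).congr' heq

/-! ## §3 Schur: `Ad(SU(n))`-invariant positive forms on `𝔰𝔲(n)` are multiples of the Hilbert–Schmidt form -/

/-- **The Lie algebra of `SU(n)` is `𝔰𝔲(n)`**: `e^{tX} ∈ SU(n)` for all real `t` iff `Xᴴ = −X` and `tr X = 0`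
(tree `matrixLieAlgebra_specialUnitaryGroup`, restated for `MatrixLie.lieSet`; `SU(n)` is a closed unitary matrix group
by the tree's `B12SemisimpleNormalTori.isClosedUnitaryGroup_specialUnitaryGroup`). [cite: Hall2015, Prop. 3.24] -/
theorem mem_lieSet_specialUnitaryGroup_iff {X : Matrix n n ℂ} :
    X ∈ MatrixLie.lieSet (Matrix.specialUnitaryGroup n ℂ : Set (Matrix n n ℂ)) ↔ Xᴴ = -X ∧ X.trace = 0 := by
  have hS := isClosedUnitaryGroup_specialUnitaryGroup (n := n)
  rw [MatrixLie.mem_lieSet, ← mem_matrixLieAlgebra_iff hS.one_mem (fun a ha b hb => hS.mul_mem ha hb)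
    hS.isClosed, matrixLieAlgebra_specialUnitaryGroup, Submodule.mem_inf, LinearMap.mem_ker,
    Matrix.traceLinearMap_apply]
  exact and_congr_left' ((skewAdjoint.mem_iff (x := X)).trans (by rw [Matrix.star_eq_conjTranspose]))

/-- `⟨UXUᴴ, UYUᴴ⟩_HS = ⟨X, Y⟩_HS` for `UᴴU = 1`. [cite: Hall2015, Def. 2.2 and (2.2)] -/
theorem hsForm_conj_of_conjTranspose_mul_self {U : Matrix n n ℂ} (hU : Uᴴ * U = 1) (X Y : Matrix n n ℂ) :
    hsForm (U * X * Uᴴ) (U * Y * Uᴴ) = hsForm X Y := by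
  rw [hsForm_def, hsForm_def, Matrix.conjTranspose_mul, Matrix.conjTranspose_mul,
    Matrix.conjTranspose_conjTranspose]
  have h : U * (Xᴴ * Uᴴ) * (U * Y * Uᴴ) = U * (Xᴴ * Y) * Uᴴ := by
    simp only [Matrix.mul_assoc]
    rw [← Matrix.mul_assoc Uᴴ U (Y * Uᴴ), hU, Matrix.one_mul]
  rw [h, Matrix.trace_mul_cycle, hU, Matrix.one_mul]

/-- **SCHUR'S LEMMA FOR THE ADJOINT REPRESENTATION OF `SU(n)`**: a real bilinear form `B` on `M_n(ℂ)` which on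
`𝔰𝔲(n)` is symmetric, positive semi-definite and invariant under `X ↦ e^{tZ} X e^{−tZ}` (`Z ∈ 𝔰𝔲(n)`, `t ∈ ℝ`) is a
non-negative multiple of the Hilbert–Schmidt form there: `B X Y = c·Re tr(XᴴY)` for all `X, Y ∈ 𝔰𝔲(n)`.  Proof: `c` is
the minimum of the Rayleigh quotient `B(X,X)/‖X‖²_HS` on `𝔰𝔲(n) ∖ 0`; the radical of the positive form `B − c·HS` is a
non-zero `Ad`-stable subspace, hence all of `𝔰𝔲(n)` by irreducibility (tree `eq_bot_or_forall_mem_of_forall_conj_exp_mem`).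
[cite: Hall2015, Prop. 7.31 and Thm. 3.20 (4)] [cite: Kumar2021, App. A, Def. A.1] -/
theorem exists_eq_mul_hsForm_of_conj_exp_invariant [Nonempty n]
    (B : Matrix n n ℂ →ₗ[ℝ] Matrix n n ℂ →ₗ[ℝ] ℝ)
    (hsymm : ∀ X ∈ MatrixLie.lieSet (Matrix.specialUnitaryGroup n ℂ : Set (Matrix n n ℂ)),
      ∀ Y ∈ MatrixLie.lieSet (Matrix.specialUnitaryGroup n ℂ : Set (Matrix n n ℂ)), B X Y = B Y X)
    (hpos : ∀ X ∈ MatrixLie.lieSet (Matrix.specialUnitaryGroup n ℂ : Set (Matrix n n ℂ)), 0 ≤ B X X)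
    (hinv : ∀ Z ∈ MatrixLie.lieSet (Matrix.specialUnitaryGroup n ℂ : Set (Matrix n n ℂ)), ∀ t : ℝ,
      ∀ X ∈ MatrixLie.lieSet (Matrix.specialUnitaryGroup n ℂ : Set (Matrix n n ℂ)),
      ∀ Y ∈ MatrixLie.lieSet (Matrix.specialUnitaryGroup n ℂ : Set (Matrix n n ℂ)),
        B (exp (t • Z) * X * exp (t • (-Z))) (exp (t • Z) * Y * exp (t • (-Z))) = B X Y) :
    ∃ c : ℝ, 0 ≤ c ∧ ∀ X ∈ MatrixLie.lieSet (Matrix.specialUnitaryGroup n ℂ : Set (Matrix n n ℂ)),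
      ∀ Y ∈ MatrixLie.lieSet (Matrix.specialUnitaryGroup n ℂ : Set (Matrix n n ℂ)), B X Y = c * hsForm X Y := by
  classical
  have hSU := isClosedUnitaryGroup_specialUnitaryGroup (n := n)
  -- abbreviations: the set `𝔰 = 𝔰𝔲(n)` and the submodule `L` with carrier `𝔰`
  obtain ⟨𝔰, h𝔰⟩ : ∃ 𝔰, MatrixLie.lieSet (Matrix.specialUnitaryGroup n ℂ : Set (Matrix n n ℂ)) = 𝔰 := ⟨_, rfl⟩
  rw [h𝔰] at hsymm hpos hinv ⊢
  let L : Submodule ℝ (Matrix n n ℂ) := MatrixLie.lieAlg hSU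
  have hL : ∀ {X}, X ∈ L ↔ X ∈ 𝔰 := fun {X} => by rw [← h𝔰]; rfl
  have hsmul : ∀ {X} (a : ℝ), X ∈ 𝔰 → a • X ∈ 𝔰 := fun a hX => hL.1 (L.smul_mem a (hL.2 hX))
  have hadd : ∀ {X Y}, X ∈ 𝔰 → Y ∈ 𝔰 → X + Y ∈ 𝔰 := fun hX hY => hL.1 (L.add_mem (hL.2 hX) (hL.2 hY))
  have hzero : (0 : Matrix n n ℂ) ∈ 𝔰 := hL.1 L.zero_mem
  -- the degenerate case `𝔰 = 0`
  by_cases hnt : ∃ X ∈ 𝔰, X ≠ 0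
  swap
  · push Not at hnt
    refine ⟨0, le_rfl, fun X hX Y hY => ?_⟩
    rw [hnt X hX, map_zero, LinearMap.zero_apply, zero_mul]
  obtain ⟨X₁, hX₁, hX₁0⟩ := hnt
  -- the Rayleigh quotient on the compact set `K = 𝔰 ∩ sphere`
  obtain ⟨K, hK⟩ : ∃ K, 𝔰 ∩ Metric.sphere (0 : Matrix n n ℂ) 1 = K := ⟨_, rfl⟩
  have hKc : IsCompact K := by
    rw [← hK, ← h𝔰]
    exact (isCompact_sphere 0 1).inter_left (MatrixLie.isClosed_lieAlg hSU)
  have hsph : ∀ X ∈ 𝔰, X ≠ 0 → ‖X‖⁻¹ • X ∈ K := fun X hX hX0 => by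
    rw [← hK]
    refine ⟨hsmul _ hX, ?_⟩
    rw [mem_sphere_zero_iff_norm, norm_smul, norm_inv, norm_norm, inv_mul_cancel₀ (norm_ne_zero_iff.2 hX0)]
  have hKne : K.Nonempty := ⟨_, hsph X₁ hX₁ hX₁0⟩
  have hK0 : ∀ X ∈ K, X ≠ 0 := fun X hX h0 => by
    rw [← hK] at hX
    have h := hX.2
    rw [h0, mem_sphere_zero_iff_norm, norm_zero] at h
    exact zero_ne_one h
  have hK𝔰 : ∀ X ∈ K, X ∈ 𝔰 := fun X hX => by rw [← hK] at hX; exact hX.1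
  have hqc : ContinuousOn (fun X => B X X / hsForm X X) K :=
    ((continuous_bilin_uncurry B).comp (continuous_id.prodMk continuous_id)).continuousOn.div
      continuous_hsForm_self.continuousOn fun X hX => (hsForm_self_pos (hK0 X hX)).ne'
  obtain ⟨X₀, hX₀K, hmin⟩ := hKc.exists_isMinOn hKne hqc
  have hX₀0 : X₀ ≠ 0 := hK0 X₀ hX₀K
  have hX₀ : X₀ ∈ 𝔰 := hK𝔰 X₀ hX₀K
  obtain ⟨c, hc⟩ : ∃ c, B X₀ X₀ / hsForm X₀ X₀ = c := ⟨_, rfl⟩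
  have hc0 : 0 ≤ c := hc ▸ div_nonneg (hpos X₀ hX₀) (hsForm_self_nonneg X₀)
  have h00 : B X₀ X₀ = c * hsForm X₀ X₀ := by
    rw [← hc, div_mul_cancel₀ _ (hsForm_self_pos hX₀0).ne']
  -- (i) `c·‖X‖²_HS ≤ B(X, X)` on `𝔰`
  have hge : ∀ X ∈ 𝔰, c * hsForm X X ≤ B X X := by
    intro X hX
    by_cases hX0 : X = 0
    · subst hX0
      simp only [map_zero, (hsForm_self_eq_zero_iff (0 : Matrix n n ℂ)).2 rfl, mul_zero, le_refl]
    · have h := (isMinOn_iff.1 hmin) _ (hsph X hX hX0)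
      have hnorm : ‖X‖ ≠ 0 := norm_ne_zero_iff.2 hX0
      have hq : B (‖X‖⁻¹ • X) (‖X‖⁻¹ • X) / hsForm (‖X‖⁻¹ • X) (‖X‖⁻¹ • X) = B X X / hsForm X X := by
        simp only [map_smul, LinearMap.smul_apply, smul_eq_mul, hsForm_smul_left, hsForm_smul_right]
        have hh : hsForm X X ≠ 0 := (hsForm_self_pos hX0).ne'
        field_simp
      rw [hq, hc] at h
      exact (le_div_iff₀ (hsForm_self_pos hX0)).1 h
  -- (ii) the radical `R` of `B − c·HS` inside `𝔰`
  let R : Submodule ℝ (Matrix n n ℂ) :=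
    { carrier := {X | X ∈ 𝔰 ∧ ∀ Y ∈ 𝔰, B X Y = c * hsForm X Y}
      add_mem' := fun {X X'} hX hX' => ⟨hadd hX.1 hX'.1, fun Y hY => by
        rw [map_add, LinearMap.add_apply, hX.2 Y hY, hX'.2 Y hY, hsForm_add_left, mul_add]⟩
      zero_mem' := ⟨hzero, fun Y _ => by
        rw [map_zero, LinearMap.zero_apply, hsForm_def, Matrix.conjTranspose_zero, Matrix.zero_mul,
          Matrix.trace_zero, Complex.zero_re, mul_zero]⟩
      smul_mem' := fun a X hX => ⟨hsmul a hX.1, fun Y hY => by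
        rw [map_smul, LinearMap.smul_apply, smul_eq_mul, hX.2 Y hY, hsForm_smul_left]; ring⟩ }
  have hRmem : ∀ {X}, X ∈ R ↔ X ∈ 𝔰 ∧ ∀ Y ∈ 𝔰, B X Y = c * hsForm X Y := fun {X} => Iff.rfl
  -- `X₀ ∈ R`: positivity of `B − c·HS` and vanishing at `X₀`
  have hX₀R : X₀ ∈ R := by
    refine hRmem.2 ⟨hX₀, fun Y hY => ?_⟩
    obtain ⟨a, ha⟩ : ∃ a, B X₀ Y - c * hsForm X₀ Y = a := ⟨_, rfl⟩
    obtain ⟨b, hb⟩ : ∃ b, B Y Y - c * hsForm Y Y = b := ⟨_, rfl⟩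
    have hb0 : 0 ≤ b := hb ▸ sub_nonneg.2 (hge Y hY)
    have key : ∀ t : ℝ, 0 ≤ 2 * t * a + t ^ 2 * b := by
      intro t
      have h := hge _ (hadd hX₀ (hsmul t hY))
      have e1 : B (X₀ + t • Y) (X₀ + t • Y) = B X₀ X₀ + 2 * t * B X₀ Y + t ^ 2 * B Y Y := by
        simp only [map_add, map_smul, LinearMap.add_apply, LinearMap.smul_apply, smul_eq_mul]
        rw [hsymm Y hY X₀ hX₀]; ring
      have e2 : hsForm (X₀ + t • Y) (X₀ + t • Y) =
          hsForm X₀ X₀ + 2 * t * hsForm X₀ Y + t ^ 2 * hsForm Y Y := by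
        rw [hsForm_add_left, hsForm_add_right, hsForm_add_right, hsForm_smul_left, hsForm_smul_left,
          hsForm_smul_right, hsForm_smul_right, hsForm_comm Y X₀]; ring
      rw [e1, e2] at h
      have h' : 2 * t * a + t ^ 2 * b = (B X₀ X₀ + 2 * t * B X₀ Y + t ^ 2 * B Y Y -
          c * (hsForm X₀ X₀ + 2 * t * hsForm X₀ Y + t ^ 2 * hsForm Y Y)) - (B X₀ X₀ - c * hsForm X₀ X₀) := by
        rw [← ha, ← hb]; ring
      have h00' : B X₀ X₀ - c * hsForm X₀ X₀ = 0 := by rw [h00, sub_self]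
      rw [h', h00', sub_zero]
      exact sub_nonneg.2 h
    have hb1 : 0 < b + 1 := by linarith
    have h := key (-a / (b + 1))
    have h2 : 2 * (-a / (b + 1)) * a + (-a / (b + 1)) ^ 2 * b = -(a ^ 2 * (b + 2)) / (b + 1) ^ 2 := by
      field_simp; ring
    rw [h2] at h
    have h3 : 0 ≤ -(a ^ 2 * (b + 2)) := by
      have h4 := mul_nonneg h (le_of_lt (pow_pos hb1 2))
      rwa [div_mul_cancel₀ _ (pow_pos hb1 2).ne'] at h4
    have ha0 : a = 0 := by nlinarith [sq_nonneg a]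
    rw [← sub_eq_zero, ha, ha0]
  -- `R` is `Ad(e^{tZ})`-stable
  have hRinv : ∀ Z : Matrix n n ℂ, Zᴴ = -Z → Z.trace = 0 → ∀ (t : ℝ), ∀ w ∈ R,
      exp (t • Z) * w * exp (t • (-Z)) ∈ R := by
    intro Z hZ hZtr t w hw
    obtain ⟨hw𝔰, hwR⟩ := hRmem.1 hw
    have hZ𝔰 : Z ∈ 𝔰 := h𝔰 ▸ mem_lieSet_specialUnitaryGroup_iff.2 ⟨hZ, hZtr⟩
    have hnZ𝔰 : -Z ∈ 𝔰 := by simpa using hsmul (-1) hZ𝔰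
    obtain ⟨U, hU⟩ : ∃ U, exp (t • Z) = U := ⟨_, rfl⟩
    obtain ⟨V, hV⟩ : ∃ V, exp (t • (-Z)) = V := ⟨_, rfl⟩
    have hUstar : Uᴴ = V := by
      rw [← hU, ← hV, ← Matrix.star_eq_conjTranspose, star_exp_smul_of_conjTranspose_eq_neg hZ]
    have hVstar : Vᴴ = U := by rw [← hUstar, Matrix.conjTranspose_conjTranspose]
    have hZ' : Z ∈ MatrixLie.lieSet (Matrix.specialUnitaryGroup n ℂ : Set (Matrix n n ℂ)) := by
      rw [h𝔰]; exact hZ𝔰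
    have hnZ' : -Z ∈ MatrixLie.lieSet (Matrix.specialUnitaryGroup n ℂ : Set (Matrix n n ℂ)) := by
      rw [h𝔰]; exact hnZ𝔰
    have hUS : U ∈ (Matrix.specialUnitaryGroup n ℂ : Set (Matrix n n ℂ)) := hU ▸ hZ' t
    have hVS : V ∈ (Matrix.specialUnitaryGroup n ℂ : Set (Matrix n n ℂ)) := hV ▸ hnZ' t
    have hVU : V * U = 1 := by rw [← hUstar]; exact hSU.star_mul_self hUS
    have hUV : U * V = 1 := by rw [← hUstar]; exact hSU.mul_star_self hUS
    have hconjU : ∀ X ∈ 𝔰, U * X * V ∈ 𝔰 := fun X hX => by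
      have h := hL.1 (MatrixLie.conj_mem_lieAlg hSU hUS (hL.2 hX))
      rwa [hSU.inv_eq_star hUS, hUstar] at h
    have hconjV : ∀ X ∈ 𝔰, V * X * U ∈ 𝔰 := fun X hX => by
      have h := hL.1 (MatrixLie.conj_mem_lieAlg hSU hVS (hL.2 hX))
      rwa [hSU.inv_eq_star hVS, hVstar] at h
    rw [hU, hV]
    refine hRmem.2 ⟨hconjU w hw𝔰, fun Y hY => ?_⟩
    have e : Y = U * (V * Y * U) * V := by
      have h1 : U * (V * Y * U) * V = U * V * Y * (U * V) := by simp only [Matrix.mul_assoc]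
      rw [h1, hUV, Matrix.one_mul, Matrix.mul_one]
    have hinv' := hinv Z hZ𝔰 t w hw𝔰 (V * Y * U) (hconjV Y hY)
    rw [hU, hV] at hinv'
    calc B (U * w * V) Y = B (U * w * V) (U * (V * Y * U) * V) := by rw [← e]
      _ = B w (V * Y * U) := hinv'
      _ = c * hsForm w (V * Y * U) := hwR _ (hconjV Y hY)
      _ = c * hsForm (U * w * Uᴴ) (U * (V * Y * U) * Uᴴ) := by
          rw [hsForm_conj_of_conjTranspose_mul_self (by rw [hUstar]; exact hVU)]
      _ = c * hsForm (U * w * V) Y := by rw [hUstar, ← e]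
  -- irreducibility
  have hle : ∀ X ∈ R, Xᴴ = -X ∧ X.trace = 0 := fun X hX =>
    mem_lieSet_specialUnitaryGroup_iff.1 (h𝔰 ▸ (hRmem.1 hX).1)
  rcases eq_bot_or_forall_mem_of_forall_conj_exp_mem R hle hRinv with hbot | htop
  · exact absurd ((Submodule.mem_bot ℝ).1 (hbot ▸ hX₀R)) hX₀0
  · refine ⟨c, hc0, fun X hX Y hY => ?_⟩
    obtain ⟨hX', htr⟩ := mem_lieSet_specialUnitaryGroup_iff.1 (h𝔰 ▸ hX :)
    exact (hRmem.1 (htop X hX' htr)).2 Y hY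

/-! ## §4 The derived map of a unitary representation of `SU(n)` (Hall, Thm. 3.28) -/

/-- **THE DERIVED MAP `φ = dr` OF A FAITHFUL UNITARY REPRESENTATION `r` OF `SU(n)`** (Hall, Thm. 3.28 with (1) and
Prop. 3.31): a real-linear `φ : M_n(ℂ) → M_N(ℂ)` with `r(g) = e^{tφ(X)}` whenever `g = e^{tX}`, `X ∈ 𝔰𝔲(n)`;
`Ad`-equivariant, `φ(uXu⁻¹) = r(u)φ(X)r(u)⁻¹`; and injective on `𝔰𝔲(n)` (faithfulness: `φ X = 0` forces
`r(e^{tX}) = 1`, so `e^{tX} = 1` for all `t`).  Off `𝔰𝔲(n)` the values of `φ` are unspecified.  Read off the tree's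
`Literature.Analysis.Calculus.exists_linearMap_apply_exp_smul_eq` for the closed linear group `SU(n) ⊆ M_n(ℂ)` and the
extension of `r` by `1`. [cite: Hall2015, Thm. 3.28 and Prop. 3.31] -/
theorem _root_.Literature.MathematicalPhysics.QuantumFieldTheory.LatticeRep.exists_derivedMap
    (r : LatticeRep (Matrix.specialUnitaryGroup n ℂ)) :
    ∃ φ : Matrix n n ℂ →ₗ[ℝ] Matrix (Fin r.N) (Fin r.N) ℂ,
      (∀ X ∈ MatrixLie.lieSet (Matrix.specialUnitaryGroup n ℂ : Set (Matrix n n ℂ)), ∀ (t : ℝ)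
        (g : Matrix.specialUnitaryGroup n ℂ), (g : Matrix n n ℂ) = exp (t • X) → r.ρ g = exp (t • φ X)) ∧
      (∀ X ∈ MatrixLie.lieSet (Matrix.specialUnitaryGroup n ℂ : Set (Matrix n n ℂ)),
        ∀ u : Matrix.specialUnitaryGroup n ℂ,
          φ ((u : Matrix n n ℂ) * X * ((u⁻¹ : Matrix.specialUnitaryGroup n ℂ) : Matrix n n ℂ)) =
            r.ρ u * φ X * r.ρ u⁻¹) ∧
      (∀ X ∈ MatrixLie.lieSet (Matrix.specialUnitaryGroup n ℂ : Set (Matrix n n ℂ)), φ X = 0 → X = 0) := by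
  classical
  have hS := isClosedUnitaryGroup_specialUnitaryGroup (n := n)
  -- the extension `Φ` of `r.ρ` to all of `M_n(ℂ)` (junk value `1` off `SU(n)`)
  obtain ⟨Φ, hΦ⟩ : ∃ Φ : Matrix n n ℂ → Matrix (Fin r.N) (Fin r.N) ℂ,
      ∀ g : Matrix.specialUnitaryGroup n ℂ, Φ g = r.ρ g :=
    ⟨fun A => if h : A ∈ Matrix.specialUnitaryGroup n ℂ then r.ρ ⟨A, h⟩ else 1, fun g => by
      simp only [SetLike.coe_mem, ↓reduceDIte, Subtype.coe_eta]⟩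
  have h1 : (1 : Matrix n n ℂ) ∈ (Matrix.specialUnitaryGroup n ℂ : Set (Matrix n n ℂ)) := hS.one_mem
  have hmul : ∀ a ∈ (Matrix.specialUnitaryGroup n ℂ : Set (Matrix n n ℂ)),
      ∀ b ∈ (Matrix.specialUnitaryGroup n ℂ : Set (Matrix n n ℂ)),
        a * b ∈ (Matrix.specialUnitaryGroup n ℂ : Set (Matrix n n ℂ)) := fun a ha b hb => hS.mul_mem ha hb
  have hinv : ∀ a ∈ (Matrix.specialUnitaryGroup n ℂ : Set (Matrix n n ℂ)),
      ∃ b ∈ (Matrix.specialUnitaryGroup n ℂ : Set (Matrix n n ℂ)), b * a = 1 :=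
    fun a ha => ⟨aᴴ, hS.star_mem ha, hS.star_mul_self ha⟩
  have hΦ1 : Φ 1 = 1 := by
    have h := hΦ 1
    rwa [map_one] at h
  have hΦmul : ∀ a ∈ (Matrix.specialUnitaryGroup n ℂ : Set (Matrix n n ℂ)),
      ∀ b ∈ (Matrix.specialUnitaryGroup n ℂ : Set (Matrix n n ℂ)), Φ (a * b) = Φ a * Φ b := by
    intro a ha b hb
    have h := hΦ (⟨a, ha⟩ * ⟨b, hb⟩)
    rw [map_mul, ← hΦ, ← hΦ] at h
    exact h
  have hΦc : ContinuousOn Φ (Matrix.specialUnitaryGroup n ℂ : Set (Matrix n n ℂ)) := by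
    rw [continuousOn_iff_continuous_restrict]
    have h : (Matrix.specialUnitaryGroup n ℂ : Set (Matrix n n ℂ)).restrict Φ =
        fun g : Matrix.specialUnitaryGroup n ℂ => r.ρ g := funext fun g => hΦ g
    rw [h]
    exact r.continuous
  obtain ⟨φ, hφ⟩ := Literature.Analysis.Calculus.exists_linearMap_apply_exp_smul_eq hS.isClosed h1 hmul hinv
    hΦc hΦ1 hΦmul
  refine ⟨φ, fun X hX t g hg => ?_, fun X hX u => ?_, fun X hX h0 => ?_⟩
  · rw [← hΦ g, hg]
    exact hφ X hX t
  · -- `Ad`-equivariance, by uniqueness of generators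
    have hu : (u : Matrix n n ℂ) ∈ (Matrix.specialUnitaryGroup n ℂ : Set (Matrix n n ℂ)) := u.2
    have hu' : ((u⁻¹ : Matrix.specialUnitaryGroup n ℂ) : Matrix n n ℂ) ∈
        (Matrix.specialUnitaryGroup n ℂ : Set (Matrix n n ℂ)) := (u⁻¹).2
    have huu : ((u⁻¹ : Matrix.specialUnitaryGroup n ℂ) : Matrix n n ℂ) * (u : Matrix n n ℂ) = 1 := by
      rw [← Submonoid.coe_mul, inv_mul_cancel, Submonoid.coe_one]
    have hXu : (u : Matrix n n ℂ) * X * ((u⁻¹ : Matrix.specialUnitaryGroup n ℂ) : Matrix n n ℂ) ∈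
        MatrixLie.lieSet (Matrix.specialUnitaryGroup n ℂ : Set (Matrix n n ℂ)) := by
      have h := MatrixLie.conj_mem_lieAlg hS hu (X := X) hX
      rwa [hS.inv_eq_star hu, ← Matrix.star_eq_conjTranspose] at h
    refine Literature.Analysis.OperatorTheory.generator_unique fun t => ?_
    rw [← hφ _ hXu t, Literature.Analysis.Calculus.apply_exp_smul_conj_eq hmul hinv hΦ1 hΦmul hu hu' huu hX
      (hφ X hX) t, hΦ, hΦ]
  · -- injectivity on `𝔰𝔲(n)`, by faithfulness
    have h := (Literature.Analysis.Calculus.forall_apply_exp_smul_eq_one_iff (hφ X hX)).2 h0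
    refine Literature.Analysis.OperatorTheory.generator_unique (X' := 0) fun t => ?_
    rw [smul_zero, exp_zero]
    have h2 : r.ρ ⟨exp (t • X), hX t⟩ = r.ρ 1 := by rw [map_one, ← hΦ]; exact h t
    exact congrArg Subtype.val (r.injective h2)

/-! ## §5 The Dynkin index in Hilbert–Schmidt units and the trace-defect ratio at the identity -/

/-- **THE DYNKIN INDEX OF `r` IN HILBERT–SCHMIDT UNITS AND THE TRACE DEFECT AT THE IDENTITY.**  For a faithful
continuous unitary representation `r` of `SU(n)` (`n ≥ 1`) there are `κ > 0` and the derived map `φ` of §4 with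
`Re tr((φX)ᴴ(φY)) = κ·Re tr(XᴴY)` for all `X, Y ∈ 𝔰𝔲(n)` (the pull-back of the trace form of `𝔲(N)` along `dr` is
`Ad`-invariant, hence a multiple of the trace form of `𝔰𝔲(n)` — the Dynkin index, `d_f ≥ 0`, here `> 0` by
faithfulness), and
**`(N − Re tr r(h)) ∕ (n − Re tr h) → κ` as `h → 1`, `h ≠ 1`** (chart `h = e^{X}`, `X = mlog h → 0`, §1–§2).
For `n = 1` the group is trivial, the punctured filter is `⊥`, and `κ = 1` is returned.
[cite: Kumar2021, App. A, Def. A.1] [cite: Hall2015, Thm. 3.28 and Prop. 7.31] -/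
theorem _root_.Literature.MathematicalPhysics.QuantumFieldTheory.LatticeRep.exists_dynkinIndexHS_tendsto [Nonempty n]
    (r : LatticeRep (Matrix.specialUnitaryGroup n ℂ)) :
    ∃ (κ : ℝ) (φ : Matrix n n ℂ →ₗ[ℝ] Matrix (Fin r.N) (Fin r.N) ℂ), 0 < κ ∧
      (∀ X ∈ MatrixLie.lieSet (Matrix.specialUnitaryGroup n ℂ : Set (Matrix n n ℂ)), ∀ (t : ℝ)
        (g : Matrix.specialUnitaryGroup n ℂ), (g : Matrix n n ℂ) = exp (t • X) → r.ρ g = exp (t • φ X)) ∧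
      (∀ X ∈ MatrixLie.lieSet (Matrix.specialUnitaryGroup n ℂ : Set (Matrix n n ℂ)),
        ∀ Y ∈ MatrixLie.lieSet (Matrix.specialUnitaryGroup n ℂ : Set (Matrix n n ℂ)),
          hsForm (φ X) (φ Y) = κ * hsForm X Y) ∧
      Tendsto (fun h : Matrix.specialUnitaryGroup n ℂ =>
          ((r.N : ℝ) - (r.ρ h).trace.re) / ((Fintype.card n : ℝ) - (h : Matrix n n ℂ).trace.re))
        (𝓝[≠] 1) (𝓝 κ) := by
  classical
  have hS := isClosedUnitaryGroup_specialUnitaryGroup (n := n)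
  obtain ⟨φ, hφ, hφconj, hφinj⟩ := r.exists_derivedMap
  -- the pulled-back Hilbert–Schmidt form and Schur
  let B : Matrix n n ℂ →ₗ[ℝ] Matrix n n ℂ →ₗ[ℝ] ℝ :=
    LinearMap.mk₂ ℝ (fun X Y => hsForm (φ X) (φ Y))
      (fun X X' Y => by simp only [map_add, hsForm_add_left])
      (fun a X Y => by simp only [map_smul, hsForm_smul_left, smul_eq_mul])
      (fun X Y Y' => by simp only [map_add, hsForm_add_right])
      (fun a X Y => by simp only [map_smul, hsForm_smul_right, smul_eq_mul])
  have hB : ∀ X Y, B X Y = hsForm (φ X) (φ Y) := fun _ _ => rfl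
  have hunit : ∀ u : Matrix.specialUnitaryGroup n ℂ, (r.ρ u)ᴴ * r.ρ u = 1 := fun u => by
    have h := Matrix.mem_unitaryGroup_iff'.1 (r.mem_unitary u)
    rwa [Matrix.star_eq_conjTranspose] at h
  have hρinv : ∀ u : Matrix.specialUnitaryGroup n ℂ, r.ρ u⁻¹ = (r.ρ u)ᴴ := fun u => by
    have h := Matrix.inv_eq_left_inv (show r.ρ u⁻¹ * r.ρ u = 1 by rw [← map_mul, inv_mul_cancel, map_one])
    rw [← h, Matrix.inv_eq_left_inv (hunit u)]
  obtain ⟨c, -, hc⟩ := exists_eq_mul_hsForm_of_conj_exp_invariant B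
    (fun X _ Y _ => by rw [hB, hB, hsForm_comm])
    (fun X _ => by rw [hB]; exact hsForm_self_nonneg _)
    (fun Z hZ t X hX Y hY => by
      obtain ⟨u, hu⟩ : ∃ u : Matrix.specialUnitaryGroup n ℂ, (u : Matrix n n ℂ) = exp (t • Z) :=
        ⟨⟨_, hZ t⟩, rfl⟩
      have hu' : ((u⁻¹ : Matrix.specialUnitaryGroup n ℂ) : Matrix n n ℂ) = exp (t • (-Z)) := by
        rw [← star_exp_smul_of_conjTranspose_eq_neg (mem_lieSet_specialUnitaryGroup_iff.1 hZ).1 t, ← hu]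
        rfl
      rw [hB, hB, ← hu, ← hu', hφconj X hX u, hφconj Y hY u, hρinv,
        hsForm_conj_of_conjTranspose_mul_self (hunit u)])
  simp only [hB] at hc
  -- the chart at `1`
  obtain ⟨ε, hε, hchart⟩ := MatrixLie.exists_chart hS
  have hval : Tendsto (fun h : Matrix.specialUnitaryGroup n ℂ => (h : Matrix n n ℂ)) (𝓝 1) (𝓝 1) :=
    (continuous_subtype_val.tendsto (1 : Matrix.specialUnitaryGroup n ℂ))
  have hnear : ∀ᶠ h : Matrix.specialUnitaryGroup n ℂ in 𝓝[≠] 1, dist (h : Matrix n n ℂ) 1 < ε ∧ h ≠ 1 :=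
    ((Metric.tendsto_nhds.1 hval ε hε).filter_mono nhdsWithin_le_nhds).and eventually_mem_nhdsWithin
  have hne_one : ∀ h : Matrix.specialUnitaryGroup n ℂ, dist (h : Matrix n n ℂ) 1 < ε → h ≠ 1 →
      MatrixLie.mlog (h : Matrix n n ℂ) ≠ 0 := fun h hd hne h0 => by
    have h2 := (hchart _ h.2 hd).2
    rw [h0, exp_zero] at h2
    exact hne (Subtype.ext h2.symm)
  by_cases hnt : ∃ X ∈ MatrixLie.lieSet (Matrix.specialUnitaryGroup n ℂ : Set (Matrix n n ℂ)), X ≠ 0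
  swap
  · -- `𝔰𝔲(n) = 0` (`n = 1`): the group is trivial near `1`, the punctured filter is `⊥`
    push Not at hnt
    refine ⟨1, φ, one_pos, hφ, fun X hX Y hY => ?_, ?_⟩
    · rw [hnt X hX, map_zero]
      simp [hsForm_def]
    · have hbot : ∀ᶠ h : Matrix.specialUnitaryGroup n ℂ in 𝓝[≠] 1, False :=
        hnear.mono fun h hh => hne_one h hh.1 hh.2 (hnt _ (hchart _ h.2 hh.1).1)
      rw [Filter.eventually_false_iff_eq_bot.1 hbot]
      exact tendsto_bot
  obtain ⟨X₁, hX₁, hX₁0⟩ := hnt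
  have hcpos : 0 < c := by
    have h1 : 0 < hsForm (φ X₁) (φ X₁) := hsForm_self_pos fun h0 => hX₁0 (hφinj X₁ hX₁ h0)
    rw [hc X₁ hX₁ X₁ hX₁] at h1
    exact (mul_pos_iff_of_pos_right (hsForm_self_pos hX₁0)).1 h1
  refine ⟨c, φ, hcpos, hφ, hc, ?_⟩
  -- (a) `mlog ∘ (↑)` tends to `0` within `𝔰𝔲(n) ∖ 0` along the punctured neighbourhood filter of `1`
  have hml : Tendsto (fun h : Matrix.specialUnitaryGroup n ℂ => MatrixLie.mlog (h : Matrix n n ℂ)) (𝓝[≠] 1)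
      (𝓝[MatrixLie.lieSet (Matrix.specialUnitaryGroup n ℂ : Set (Matrix n n ℂ)) \ {0}] 0) := by
    refine tendsto_nhdsWithin_iff.2 ⟨(MatrixLie.tendsto_mlog.comp hval).mono_left nhdsWithin_le_nhds, ?_⟩
    exact hnear.mono fun h hh => ⟨(hchart _ h.2 hh.1).1, hne_one h hh.1 hh.2⟩
  -- (b) the ratio as a function of the logarithm
  have hG : Tendsto (fun X : Matrix n n ℂ =>
      hsForm (exp (φ X) - 1) (exp (φ X) - 1) / hsForm (exp X - 1) (exp X - 1))
      (𝓝[MatrixLie.lieSet (Matrix.specialUnitaryGroup n ℂ : Set (Matrix n n ℂ)) \ {0}] 0) (𝓝 c) := by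
    have hφt : Tendsto φ (𝓝[MatrixLie.lieSet (Matrix.specialUnitaryGroup n ℂ : Set (Matrix n n ℂ)) \ {0}] 0)
        (𝓝[≠] 0) := by
      refine tendsto_nhdsWithin_iff.2 ⟨?_, eventually_mem_nhdsWithin.mono fun X hX h0 => hX.2 (hφinj X hX.1 h0)⟩
      have h := φ.continuous_of_finiteDimensional.tendsto 0
      rw [map_zero] at h
      exact h.mono_left nhdsWithin_le_nhds
    have hM := tendsto_hsForm_exp_sub_one_div.comp hφt
    have hN : Tendsto (fun X : Matrix n n ℂ => hsForm (exp X - 1) (exp X - 1) / hsForm X X)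
        (𝓝[MatrixLie.lieSet (Matrix.specialUnitaryGroup n ℂ : Set (Matrix n n ℂ)) \ {0}] 0) (𝓝 1) :=
      tendsto_hsForm_exp_sub_one_div.mono_left (nhdsWithin_mono _ fun X hX => hX.2)
    have hlim := (hM.const_mul c).div hN one_ne_zero
    rw [mul_one, div_one] at hlim
    refine hlim.congr' (eventually_mem_nhdsWithin.mono fun X hX => ?_)
    have hX0 : hsForm X X ≠ 0 := (hsForm_self_pos hX.2).ne'
    have hc0 : c ≠ 0 := hcpos.ne'
    simp only [Pi.div_apply, Function.comp_def]
    rw [hc X hX.1 X hX.1,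
      show c * (hsForm (exp (φ X) - 1) (exp (φ X) - 1) / (c * hsForm X X)) =
        hsForm (exp (φ X) - 1) (exp (φ X) - 1) / hsForm X X by field_simp,
      div_div_div_cancel_right₀ hX0]
  -- (c) the target function is that ratio of the logarithm, near `1`
  have hEq : (fun h : Matrix.specialUnitaryGroup n ℂ =>
      hsForm (exp (φ (MatrixLie.mlog (h : Matrix n n ℂ))) - 1) (exp (φ (MatrixLie.mlog (h : Matrix n n ℂ))) - 1) /
        hsForm (exp (MatrixLie.mlog (h : Matrix n n ℂ)) - 1) (exp (MatrixLie.mlog (h : Matrix n n ℂ)) - 1))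
      =ᶠ[𝓝[≠] 1] fun h => ((r.N : ℝ) - (r.ρ h).trace.re) / ((Fintype.card n : ℝ) - (h : Matrix n n ℂ).trace.re) := by
    refine hnear.mono fun h hh => ?_
    obtain ⟨hmem, hexp⟩ := hchart _ h.2 hh.1
    have hρ : r.ρ h = exp (φ (MatrixLie.mlog (h : Matrix n n ℂ))) := by
      have h1 := hφ _ hmem 1 h (by rw [one_smul, hexp])
      rwa [one_smul] at h1
    have hnum : (r.N : ℝ) - (r.ρ h).trace.re = 1 / 2 * hsForm (r.ρ h - 1) (r.ρ h - 1) := by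
      have h1 := card_sub_trace_re_eq_half_hsForm (r.mem_unitary h)
      rwa [Fintype.card_fin] at h1
    have hden : (Fintype.card n : ℝ) - (h : Matrix n n ℂ).trace.re =
        1 / 2 * hsForm ((h : Matrix n n ℂ) - 1) ((h : Matrix n n ℂ) - 1) :=
      card_sub_trace_re_eq_half_hsForm (Matrix.specialUnitaryGroup_le_unitaryGroup h.2)
    simp only
    rw [← hρ, hexp, hnum, hden, mul_div_mul_left _ _ (by norm_num : (1 / 2 : ℝ) ≠ 0)]
  exact (hG.comp hml).congr' hEq

/-- **`(N − Re tr r(h)) ∕ (n − Re tr h) → κ_r > 0` as `h → 1`, `h ≠ 1`, in `SU(n)`** (`n ≥ 1`), for every faithful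
continuous unitary matrix representation `r` of `SU(n)` — the ratio of the Wilson plaquette energies of `r` and of
the fundamental representation at small field; `κ_r` is the Dynkin index of `r` in Hilbert–Schmidt units
(`exists_dynkinIndexHS_tendsto`). [cite: Kumar2021, App. A, Def. A.1] [cite: Hall2015, Thm. 3.28 and Prop. 7.31] -/
theorem _root_.Literature.MathematicalPhysics.QuantumFieldTheory.LatticeRep.exists_tendsto_traceDefect_ratio
    [Nonempty n] (r : LatticeRep (Matrix.specialUnitaryGroup n ℂ)) :
    ∃ κ : ℝ, 0 < κ ∧ Tendsto (fun h : Matrix.specialUnitaryGroup n ℂ =>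
        ((r.N : ℝ) - (r.ρ h).trace.re) / ((Fintype.card n : ℝ) - (h : Matrix n n ℂ).trace.re))
      (𝓝[≠] 1) (𝓝 κ) := by
  obtain ⟨κ, _, hκ, _, _, h⟩ := r.exists_dynkinIndexHS_tendsto
  exact ⟨κ, hκ, h⟩

/-- **The `Fin N` form** (`N ≥ 1`): for `r : LatticeRep SU(N)`,
`(r.N − Re tr r(h)) ∕ (N − Re tr h) → κ > 0` as `h → 1`, `h ≠ 1` — the hypothesis `(Q)` of the `r`-port of the
twisted-slab anchor (`Theorems/BalabanLadderIRTwistedSlabRepSandwich.lean`), discharged for EVERY faithful unitary `r`.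
[cite: Kumar2021, App. A, Def. A.1] [cite: Hall2015, Thm. 3.28 and Prop. 7.31] -/
theorem _root_.Literature.MathematicalPhysics.QuantumFieldTheory.LatticeRep.exists_tendsto_traceDefect_ratio_fin
    {N : ℕ} (hN : 1 ≤ N) (r : LatticeRep (Matrix.specialUnitaryGroup (Fin N) ℂ)) :
    ∃ κ : ℝ, 0 < κ ∧ Tendsto (fun h : Matrix.specialUnitaryGroup (Fin N) ℂ =>
        ((r.N : ℝ) - (r.ρ h).trace.re) / ((N : ℝ) - (h : Matrix (Fin N) (Fin N) ℂ).trace.re))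
      (𝓝[≠] 1) (𝓝 κ) := by
  haveI : Nonempty (Fin N) := ⟨⟨0, hN⟩⟩
  simpa only [Fintype.card_fin] using r.exists_tendsto_traceDefect_ratio

/-- **Sanity: for the fundamental representation the ratio is identically `1` off `h = 1`**, so the limit is `1`
(`n − Re tr h = ½‖h − 1‖²_HS > 0` for unitary `h ≠ 1`). [cite: Hall2015, Def. 2.2 and (2.2)] -/
theorem tendsto_traceDefect_ratio_fundamental :
    Tendsto (fun h : Matrix.specialUnitaryGroup n ℂ =>
        ((Fintype.card n : ℝ) - (fundamentalRep n h).trace.re) /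
          ((Fintype.card n : ℝ) - (h : Matrix n n ℂ).trace.re)) (𝓝[≠] 1) (𝓝 1) := by
  refine tendsto_const_nhds.congr' (eventually_mem_nhdsWithin.mono fun h hh => ?_)
  have hne : (h : Matrix n n ℂ) - 1 ≠ 0 := fun h0 => hh (Subtype.ext (sub_eq_zero.1 h0))
  have hpos : 0 < (Fintype.card n : ℝ) - (h : Matrix n n ℂ).trace.re := by
    rw [card_sub_trace_re_eq_half_hsForm (Matrix.specialUnitaryGroup_le_unitaryGroup h.2)]
    exact mul_pos (by norm_num) (hsForm_self_pos hne)
  simp only [fundamentalRep_apply]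
  rw [div_self hpos.ne']

end Literature.MathematicalPhysics.QuantumLattice
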